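import Mathlib
import Summits.Ventures.PercRepro2.SwOutMultiRootDefs
import Summits.Ventures.PercRepro2.SwOutCoreCube
import Summits.Ventures.PercRepro2.SwOutArmGTyped

/-!
# The multi-root core cube: the cluster monotonicities (blind cell PercRepro2, night-4 g34,
2026-08-29; proofs/NIGHT4-G34.md §6)

From the four avoidance lemmas of SwOutMultiRootDefs and one graph lemma — a cluster is contained in
the cluster of any colouring that agrees with the first one on the edges inside a closed set
(`cluster_subset_of_agree_within`) — the cube of a multi-root base has every property the cube
principle asks for: the red cluster and the red edge set of `h` are increasing in the cube point
(`cluster_coreReal_mono`, `redEdges_coreReal_mono`), the blue ones decreasing, the flip of the cube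
exchanges the red and the blue edge sets, the clusters of an outside vertex move the other way
(`cluster_out_coreReal_anti`, `cluster_blue_out_coreReal_mono`).  This file: the graph lemma, the
per-edge agreement of two cube points, and the four cluster monotonicities; the edge sets, the flip,
the class, the side and the inequality are in SwOutMultiRootIneq.
-/

namespace Summit.Ventures.PercRepro2

namespace LocRows

open Hull

variable {V : Type*} {E : Type*}

open scoped Classical

variable {ends : E → Sym2 V}

section Agree

/-- **Clusters through a closed set**: if the red cluster of `v` in `ω₁` stays inside a set `S`
closed under red adjacency, and `ω₂` agrees with `ω₁` on the edges inside `S`, then the cluster of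
`v` in `ω₁` lies in its cluster in `ω₂`. -/
lemma cluster_subset_of_agree_within {ω₁ ω₂ : Config E} {S : Set V} {v : V}
    (hS : ∀ x ∈ S, ∀ y, (openGraph ends ω₁).Adj x y → y ∈ S) (hv : v ∈ S)
    (hag : ∀ e ∈ within ends S, ω₁ e = ω₂ e) : cluster ends ω₁ v ⊆ cluster ends ω₂ v := by
  let ρ : Config E := fun e => ω₁ e && decide (e ∈ within ends S)
  have hρ₁ : ρ ≤ ω₁ := fun e => by simp only [ρ]; cases ω₁ e <;> simp
  have hρS : cluster ends ρ v ⊆ S := by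
    intro x hx
    refine mem_of_conn_of_closed (ends := ends) (ω := ρ) ?_ hv hx
    intro x hx y hxy
    exact hS x hx y ((openGraph_mono hρ₁) hxy)
  have h1 : cluster ends ω₁ v ⊆ cluster ends ρ v := by
    intro x hx
    refine mem_of_conn_of_closed (ends := ends) (ω := ω₁) ?_ (mem_cluster_self _ _ _) hx
    intro x hx y hxy
    have hxS : x ∈ S := hρS hx
    have hyS : y ∈ S := hS x hxS y hxy
    obtain ⟨_, e, he, hxy'⟩ := exists_edge_of_adj hxy
    have hρe : ρ e = true := by
      simp only [ρ, he, Bool.true_and, decide_eq_true_eq]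
      exact ⟨x, hxS, y, hyS, hxy'⟩
    exact mem_cluster_of_edge hx hρe hxy'
  have hρ₂ : ρ ≤ ω₂ := by
    intro e
    by_cases he : ρ e = true
    · rw [he]
      have h' : ω₁ e = true ∧ e ∈ within ends S := by simpa [ρ] using he
      rw [← hag e h'.2, h'.1]
    · simp only [Bool.not_eq_true] at he
      rw [he]; exact Bool.false_le _
  exact h1.trans (cluster_mono hρ₂ v)

end Agree

section Cube

variable {ι : Type*} {A : ι → Set V} {ζ : Config E} {R H : Set V} {h : V}
  (hb : MultiBase ends ζ R H A)
include hb

omit hb in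
/-- An edge touching the arms has an end in some arm. -/
lemma MultiBase.exists_arm_of_touches_allArms' {e : E} (he : e ∈ touches ends (allArms A)) :
    ∃ i x y, ends e = s(x, y) ∧ x ∈ A i := by
  obtain ⟨x, ⟨i, hx⟩, y, hxy⟩ := he
  exact ⟨i, x, y, hxy, hx⟩

/-- Two cube points agreeing on the arm of an end of an edge colour that edge alike. -/
lemma MultiBase.coreReal_eq_of_agree {ω ω' : Config ι} {e : E}
    (hag : ∀ i, (∃ x ∈ A i, x ∈ ends e) → ω i = ω' i) :
    coreReal ends A ζ ω e = coreReal ends A ζ ω' e := by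
  by_cases he : e ∈ touches ends (allArms A)
  · obtain ⟨i, x, y, hxy, hx⟩ := MultiBase.exists_arm_of_touches_allArms' he
    rw [hb.coreReal_apply_of_mem hxy hx, hb.coreReal_apply_of_mem hxy hx,
      hag i ⟨x, hx, by rw [hxy]; exact Sym2.mem_mk_left x y⟩]
  · rw [MultiBase.coreReal_apply_of_notMem he, MultiBase.coreReal_apply_of_notMem he]

/-- An edge inside `R ∪ armsTrueC ω` has the same colour at `ω` and at every `ω' ≥ ω`. -/
lemma MultiBase.coreReal_eq_of_within_true {ω ω' : Config ι} (hω : ω ≤ ω') {e : E}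
    (he : e ∈ within ends (R ∪ armsTrueC A ω)) :
    coreReal ends A ζ ω e = coreReal ends A ζ ω' e := by
  refine hb.coreReal_eq_of_agree fun i ⟨x, hx, hxe⟩ => ?_
  obtain ⟨a, ha, b, hb', hab⟩ := he
  rw [hab, Sym2.mem_iff] at hxe
  have key : ∀ z, z ∈ R ∪ armsTrueC A ω → z ∈ A i → ω i = true := by
    rintro z (hz | ⟨j, hj, hz⟩) hzi
    · exact absurd hzi (hb.root_notMem_arm hz i)
    · have hji : j = i := by
        by_contra hne
        exact hb.arm_disj j i hne z hz hzi
      rw [← hji]; exact hj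
  have hi : ω i = true := by
    rcases hxe with rfl | rfl
    · exact key x ha hx
    · exact key x hb' hx
  have hi' : ω' i = true := by
    have := hω i; rw [hi] at this; exact Bool.eq_true_of_true_le this
  rw [hi, hi']

/-- An edge inside `R ∪ armsFalseC ω'` has the same colour at `ω'` and at every `ω ≤ ω'`. -/
lemma MultiBase.coreReal_eq_of_within_false {ω ω' : Config ι} (hω : ω ≤ ω') {e : E}
    (he : e ∈ within ends (R ∪ armsFalseC A ω')) :
    coreReal ends A ζ ω' e = coreReal ends A ζ ω e := by
  refine hb.coreReal_eq_of_agree fun i ⟨x, hx, hxe⟩ => ?_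
  obtain ⟨a, ha, b, hb', hab⟩ := he
  rw [hab, Sym2.mem_iff] at hxe
  have key : ∀ z, z ∈ R ∪ armsFalseC A ω' → z ∈ A i → ω' i = false := by
    rintro z (hz | ⟨j, hj, hz⟩) hzi
    · exact absurd hzi (hb.root_notMem_arm hz i)
    · have hji : j = i := by
        by_contra hne
        exact hb.arm_disj j i hne z hz hzi
      rw [← hji]; exact hj
  have hi' : ω' i = false := by
    rcases hxe with rfl | rfl
    · exact key x ha hx
    · exact key x hb' hx
  have hi : ω i = false := by
    have := hω i; rw [hi'] at this; exact Bool.eq_false_of_le_false this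
  rw [hi, hi']

/-- An edge inside `Hᶜ ∪ armsFalseC ω'` has the same colour at `ω'` and at every `ω ≤ ω'`. -/
lemma MultiBase.coreReal_eq_of_within_out_false {ω ω' : Config ι} (hω : ω ≤ ω') {e : E}
    (he : e ∈ within ends (Hᶜ ∪ armsFalseC A ω')) :
    coreReal ends A ζ ω' e = coreReal ends A ζ ω e := by
  refine hb.coreReal_eq_of_agree fun i ⟨x, hx, hxe⟩ => ?_
  obtain ⟨a, ha, b, hb', hab⟩ := he
  rw [hab, Sym2.mem_iff] at hxe
  have key : ∀ z, z ∈ Hᶜ ∪ armsFalseC A ω' → z ∈ A i → ω' i = false := by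
    rintro z (hz | ⟨j, hj, hz⟩) hzi
    · exact absurd (hb.arm_sub i z hzi).1 hz
    · have hji : j = i := by
        by_contra hne
        exact hb.arm_disj j i hne z hz hzi
      rw [← hji]; exact hj
  have hi' : ω' i = false := by
    rcases hxe with rfl | rfl
    · exact key x ha hx
    · exact key x hb' hx
  have hi : ω i = false := by
    have := hω i; rw [hi'] at this; exact Bool.eq_false_of_le_false this
  rw [hi, hi']

/-- An edge inside `Hᶜ ∪ armsTrueC ω` has the same colour at `ω` and at every `ω' ≥ ω`. -/
lemma MultiBase.coreReal_eq_of_within_out_true {ω ω' : Config ι} (hω : ω ≤ ω') {e : E}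
    (he : e ∈ within ends (Hᶜ ∪ armsTrueC A ω)) :
    coreReal ends A ζ ω e = coreReal ends A ζ ω' e := by
  refine hb.coreReal_eq_of_agree fun i ⟨x, hx, hxe⟩ => ?_
  obtain ⟨a, ha, b, hb', hab⟩ := he
  rw [hab, Sym2.mem_iff] at hxe
  have key : ∀ z, z ∈ Hᶜ ∪ armsTrueC A ω → z ∈ A i → ω i = true := by
    rintro z (hz | ⟨j, hj, hz⟩) hzi
    · exact absurd (hb.arm_sub i z hzi).1 hz
    · have hji : j = i := by
        by_contra hne
        exact hb.arm_disj j i hne z hz hzi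
      rw [← hji]; exact hj
  have hi : ω i = true := by
    rcases hxe with rfl | rfl
    · exact key x ha hx
    · exact key x hb' hx
  have hi' : ω' i = true := by
    have := hω i; rw [hi] at this; exact Bool.eq_true_of_true_le this
  rw [hi, hi']

/-! ### The monotonicities -/

/-- The red cluster of a root is increasing in the cube point. -/
theorem MultiBase.cluster_coreReal_mono {r : V} (hr : r ∈ R) {ω ω' : Config ι} (hω : ω ≤ ω') :
    cluster ends (coreReal ends A ζ ω) r ⊆ cluster ends (coreReal ends A ζ ω') r :=
  cluster_subset_of_agree_within (S := R ∪ armsTrueC A ω)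
    (fun _ hx _ hxy => hb.red_closed ω hx hxy) (Or.inl hr)
    (fun _ he => hb.coreReal_eq_of_within_true hω he)

/-- The blue cluster of a root is decreasing in the cube point. -/
theorem MultiBase.cluster_blue_coreReal_anti {r : V} (hr : r ∈ R) {ω ω' : Config ι}
    (hω : ω ≤ ω') :
    cluster ends (blue (coreReal ends A ζ ω')) r ⊆ cluster ends (blue (coreReal ends A ζ ω)) r :=
  cluster_subset_of_agree_within (S := R ∪ armsFalseC A ω')
    (fun _ hx _ hxy => hb.blue_closed ω' hx hxy) (Or.inl hr)
    (fun e he => by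
      simp only [blue_apply]
      rw [hb.coreReal_eq_of_within_false hω he])

/-- The red cluster of an outside vertex is decreasing in the cube point. -/
theorem MultiBase.cluster_out_coreReal_anti {y : V} (hy : y ∉ H) {ω ω' : Config ι} (hω : ω ≤ ω') :
    cluster ends (coreReal ends A ζ ω') y ⊆ cluster ends (coreReal ends A ζ ω) y :=
  cluster_subset_of_agree_within (S := Hᶜ ∪ armsFalseC A ω')
    (fun _ hx _ hxy => hb.red_closed_out ω' hx hxy) (Or.inl hy)
    (fun _ he => hb.coreReal_eq_of_within_out_false hω he)

/-- The blue cluster of an outside vertex is increasing in the cube point. -/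
theorem MultiBase.cluster_blue_out_coreReal_mono {y : V} (hy : y ∉ H) {ω ω' : Config ι}
    (hω : ω ≤ ω') :
    cluster ends (blue (coreReal ends A ζ ω)) y ⊆ cluster ends (blue (coreReal ends A ζ ω')) y :=
  cluster_subset_of_agree_within (S := Hᶜ ∪ armsTrueC A ω)
    (fun _ hx _ hxy => hb.blue_closed_out ω hx hxy) (Or.inl hy)
    (fun e he => by
      simp only [blue_apply]
      rw [hb.coreReal_eq_of_within_out_true hω he])

/-- An edge inside the red cluster of a root at `ω` lies inside `R ∪ armsTrueC ω`. -/
lemma MultiBase.within_cluster_subset {r : V} (hr : r ∈ R) (ω : Config ι) :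
    within ends (cluster ends (coreReal ends A ζ ω) r) ⊆ within ends (R ∪ armsTrueC A ω) := by
  rintro e ⟨x, hx, y, hy, hxy⟩
  refine ⟨x, ?_, y, ?_, hxy⟩
  · rcases hb.mem_root_or_true_of_mem_cluster ω hr hx with h' | ⟨i, hi, hx'⟩
    · exact Or.inl h'
    · exact Or.inr ⟨i, hi, hx'⟩
  · rcases hb.mem_root_or_true_of_mem_cluster ω hr hy with h' | ⟨i, hi, hy'⟩
    · exact Or.inl h'
    · exact Or.inr ⟨i, hi, hy'⟩

/-- An edge inside the blue cluster of a root at `ω` lies inside `R ∪ armsFalseC ω`. -/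
lemma MultiBase.within_cluster_blue_subset {r : V} (hr : r ∈ R) (ω : Config ι) :
    within ends (cluster ends (blue (coreReal ends A ζ ω)) r) ⊆
      within ends (R ∪ armsFalseC A ω) := by
  rintro e ⟨x, hx, y, hy, hxy⟩
  refine ⟨x, ?_, y, ?_, hxy⟩
  · rcases hb.mem_root_or_false_of_mem_cluster_blue ω hr hx with h' | ⟨i, hi, hx'⟩
    · exact Or.inl h'
    · exact Or.inr ⟨i, hi, hx'⟩
  · rcases hb.mem_root_or_false_of_mem_cluster_blue ω hr hy with h' | ⟨i, hi, hy'⟩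
    · exact Or.inl h'
    · exact Or.inr ⟨i, hi, hy'⟩

end Cube

end LocRows

end Summit.Ventures.PercRepro2
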